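import Literature.Geometry.Kaehler.HolomorphicOrderAlongHypersurface
import Literature.Geometry.Kaehler.HolomorphicLineBundleSections
import Literature.Geometry.Kaehler.RiemannExtensionCodimTwo
import Literature.AlgebraicGeometry.HodgeTheory.GAGAZeroDivisorSupport
import Literature.AlgebraicGeometry.HodgeTheory.GAGADimensionConverse
import Literature.AlgebraicGeometry.HodgeTheory.GAGALocalEquation
import Literature.AlgebraicGeometry.HodgeTheory.GAGALineBundlesProofs
import Literature.AlgebraicGeometry.HodgeTheory.KodairaSerreSections
import Literature.AlgebraicGeometry.HodgeTheory.LefschetzOneOneChowProofs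
import Literature.AlgebraicGeometry.Resolution.RegularLocalRingsUFD
import Literature.AlgebraicGeometry.Motives.VarietiesRegularProofs
import Literature.AlgebraicGeometry.Motives.VarietiesQuasiCompactProofs
import Literature.AlgebraicGeometry.Motives.CartierDivisorBlowupExcess
import Literature.NumberTheory.Transcendental.AnalytificationConnectedOpen
import Literature.NumberTheory.Transcendental.AnalytificationConnectedProofs
import HarnessLib

/-!
# GAGA for line bundles with a section: the divisor of a holomorphic section is algebraic, and `L ≅ 𝒪_X((σ))^an`

J.-P. Serre, *Géométrie algébrique et géométrie analytique*, Ann. Inst. Fourier 6 (1956), n° 20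
Remarque 1 (p. 32): "lorsque `X` est une variété projective [...] tout fibré analytique `L` possède
une section méromorphe `s`; si `D` désigne le diviseur de `s`, `D` est algébrique d'après le théorème
de Chow, et `L` est isomorphe au fibré analytique défini par `D`". P. Griffiths, J. Harris,
*Principles of Algebraic Geometry* (1978), Ch. 1 §1, pp. 130–136 (the order `ord_V` of a holomorphic
section along an irreducible hypersurface `V` is well defined; "if `s` is a holomorphic section,
`L = [(s)]`"). This file PROVES these statements on the tree's carriers, for a cocycle holomorphic
line bundle `L` on an analytification `φ : M → X(ℂ)` (holomorphic atlas) of a smooth projective `X/ℂ`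
carrying a global holomorphic section `σ` with `{σ = 0} ≠ M`, in four parts:

1. `HolomorphicLineBundle.GlobalSection.exists_forall_eventuallyEq_pow_mul` (Griffiths–Harris Ch. 1
   §1: `ord_V(s)` is independent of the point and of the frame) — along a preconnected set `S'` of
   zeros of `σ` on which a holomorphic `w` with `dw ≠ 0` cuts out `{σ = 0}`, ONE exponent `N` has
   `σ_i = w^N · unit` near every point, in every frame (local normal form
   `exists_eventuallyEq_pow_mul_of_mfderiv_ne_zero`, `orderAlong`, `IsPreconnected.constant`);
   `exists_unit_of_eventuallyEq_pow_mul`: two such normal forms differ by a unit.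
2. `coheight_eq_one_of_isLocallyHypersurface` — **the components of an algebraic local hypersurface
   of `X^h` are prime divisors**: if `S ⊊ M` is locally `{h = 0}` and `S = (⋃ T)(ℂ)` for a finite
   family `T` of closed subsets of `X`, the generic point of every irreducible `Y ∈ T` not contained in
   the other members has codimension `1` (`≥ 1` as `Y ≠ X`; `≤ 1`: otherwise every regular point of
   `Y(ℂ)` would have codimension `≥ 2` by GAGA §6, `le_regularLocus_codim_of_le_coheight`, while near a
   closed point of `Y` off the other components `Y(ℂ)` is the hypersurface `S`, whose dense regular
   points have codimension `≤ 1`, `codim_le_one_of_isRegularPointOfCodim_of_eq_setOf`).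
3. `exists_cartierDivisor_localUnits` — **the divisor `(σ)` is an effective ALGEBRAIC Cartier
   divisor `D`**, with a Zariski-closed `B ⊆ X` of codimension `≥ 2` such that in every frame `U_i` and
   every chart `U_a` of `D`, near every point off `φ⁻¹(B(ℂ))`, `u · σ_i = F_a` for a holomorphic unit
   `u` (`F_a` = the local equation `f_a` read on `M`, `CartierDivisor.sectionCoord`). Construction:
   `{σ = 0} = Z₀(ℂ)` by Chow (`chow_analyticSet_analytification_holds`); irredundant components `Y_k`
   (`exists_finset_irredundant_components`), prime divisors by 2.; reduced divisors
   `D_k = ComplementDivisor.divisorOfPure` (`X` locally factorial: Auslander–Buchsbaum); good affine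
   charts `W_k ∋ η_k` on which the local equation `j_k` is an analytic local coordinate along `Y_k(ℂ)`
   (`exists_chart_mfderiv_ne_zero`, GAGA §2 n°6); bad set `B = ⋃ (Y_k ∖ W_k) ∪ ⋃_{k≠k'} Y_k ∩ Y_{k'}`;
   orders `N_k` along the connected (`isConnected_setOf_pt_mem_inter_of_isIrreducible`) smooth pieces
   `φ⁻¹((Y_k ∖ B)(ℂ))` by 1.; `D = Σ N_k D_k` (`CartierDivisor.finprod`, `sectionCoord_finprod`).
4. `analyticallyEquivalent_cartierDivisorCocycle_of_globalSection` — **`L ≅ 𝒪_X(D)^an`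
   holomorphically** (`SmoothComplexVectorBundle.AnalyticallyEquivalent L.toSmoothCocycle
   (cartierDivisorCocycle hφ D)`): the units `λ_{a i} = F_a/σ_i` glue (they agree on the dense
   `{σ_i ≠ 0}`), extend with their inverses across the codimension-`2` analytic set `φ⁻¹(B(ℂ))`
   (second Riemann extension theorem, `IsAnalyticSet.exists_mdifferentiableOn_eqOn_of_two_le_codim`,
   Fritzsche–Grauert III.6.12), and satisfy condition (C) of Fritzsche–Grauert IV §2 (`σ_i = g_{ji} σ_j`,
   `F_a = g_{ab} F_b`, density). Consequences: with the tree's `CartierDivisor.sub` (`D₁ - D₂`, Görtz–Wedhorn I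
   (11.9)) with `analyticallyEquivalent_cartierDivisorCocycle_sub` (`L ⊗ 𝒪_X(D₂)^an ≅ 𝒪_X(D₁)^an ⇒
   L ≅ 𝒪_X(D₁ - D₂)^an`), `SmoothComplexVectorBundle.toHolomorphicLineBundle` (a holomorphic rank-one
   cocycle is a holomorphic line bundle), and
   `serreGAGA_lineCocycle_iso_cartierDivisorCocycle_of_kodairaSerre`: **the named fact
   `serreGAGA_lineCocycle_iso_cartierDivisorCocycle` (`GAGALineBundles.lean`, Serre's Prop. 18 for
   `r = 1`) follows from `kodairaSerre_exists_globalSection_algebraicTwist`** (`KodairaSerreSections.lean`,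
   existence of a section `σ ≢ 0` of some `L ⊗ 𝒪_X(D₂)^an`). With
   `kodairaSerre_exists_globalSection_algebraicTwist_of_serreGAGA` (`KodairaSerreSectionsProofs.lean`)
   the two named facts are thereby equivalent in the tree; their common open core — a non-trivial
   meromorphic section of an ARBITRARY holomorphic line bundle on `X^an` (Serre n° 16–17, or Kodaira
   vanishing) — is not vendored here.

Everything in this file is proved; no named facts are introduced.

## References

* [SerreGAGA1956] J.-P. Serre, Géométrie algébrique et géométrie analytique, Ann. Inst. Fourier 6
  (1956), §2 n°6, §6 Prop. 3 Cor. 3, n° 19 Prop. 13, n° 20 Prop. 18 and Remarque 1 (pp. 31–32).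
* [GriffithsHarrisPrinciples1978] P. Griffiths, J. Harris, Principles of Algebraic Geometry (1978),
  Ch. 1 §1, pp. 130–136.
* [FritzscheGrauert2002] K. Fritzsche, H. Grauert, From Holomorphic Functions to Complex Manifolds
  (2002), Ch. III Thm. 6.12, Ch. IV §2.
* [GortzWedhorn2020] U. Görtz, T. Wedhorn, Algebraic Geometry I, 2nd ed. (2020), Section (11.9).
* [Kobayashi1987] S. Kobayashi, Differential Geometry of Complex Vector Bundles (1987), Ch. I §1.
-/

noncomputable section

/-! ## Part 1: the order of a holomorphic section along a connected smooth piece of its zero set -/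


open Set Filter Function
open scoped Topology Manifold

namespace Literature.Geometry.Kaehler

variable {E : Type*} [NormedAddCommGroup E] [NormedSpace ℂ E]
  {M : Type*} [TopologicalSpace M] [ChartedSpace E M]

/-- **Two normal forms with the same exponent differ by a unit**: if `h = w ^ N · v` and
`F = w ^ N · v'` near `m` with `v`, `v'` holomorphic near `m` and non-zero at `m`, then `F = u · h` near
`m` for `u = v'/v`, holomorphic near `m` with `u m ≠ 0`. [folklore] -/
theorem exists_unit_of_eventuallyEq_pow_mul {h F w v v' : M → ℂ} {m : M} {N : ℕ}
    (hv : ∀ᶠ x in 𝓝 m, MDifferentiableAt 𝓘(ℂ, E) 𝓘(ℂ, ℂ) v x) (hvm : v m ≠ 0)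
    (hh : ∀ᶠ x in 𝓝 m, h x = w x ^ N * v x)
    (hv' : ∀ᶠ x in 𝓝 m, MDifferentiableAt 𝓘(ℂ, E) 𝓘(ℂ, ℂ) v' x) (hv'm : v' m ≠ 0)
    (hF : ∀ᶠ x in 𝓝 m, F x = w x ^ N * v' x) :
    ∃ u : M → ℂ, (∀ᶠ x in 𝓝 m, MDifferentiableAt 𝓘(ℂ, E) 𝓘(ℂ, ℂ) u x) ∧ u m ≠ 0 ∧
      ∀ᶠ x in 𝓝 m, u x * h x = F x := by
  -- `v ≠ 0` near `m`
  have hv0 : ∀ᶠ x in 𝓝 m, v x ≠ 0 :=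
    (hv.self_of_nhds.continuousAt.eventually_ne hvm)
  refine ⟨fun x ↦ v' x / v x, ?_, div_ne_zero hv'm hvm, ?_⟩
  · filter_upwards [hv.eventually_nhds, hv'.eventually_nhds, hv0.eventually_nhds] with x hvx hv'x hv0x
    exact hv'x.self_of_nhds.div hvx.self_of_nhds hv0x.self_of_nhds
  · filter_upwards [hh, hF, hv0] with x hhx hFx hv0x
    rw [hhx, hFx]
    field_simp

namespace HolomorphicLineBundle.GlobalSection

variable [IsManifold 𝓘(ℂ, E) 1 M] {ι : Type*} {L : HolomorphicLineBundle ι E M}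

/-- **The order of a holomorphic section along a connected smooth piece of its zero set is well
defined** (Griffiths–Harris, Ch. 1 §1: `ord_V` does not depend on the point of `V` nor on the
frame). Let `σ` be a global holomorphic section of the cocycle line bundle `L`, `S' ⊆ M` preconnected,
`w` holomorphic on an open `W ⊇ S'` with `w = 0` and `dw ≠ 0` on `S'`, and suppose that near each
point of `S'` the zero set of `σ` is `{w = 0}`. Then for one `N : ℕ`: near every `m ∈ S'`, in every
frame `i` with `m ∈ U_i`, `σ_i = w ^ N · v` with `v` holomorphic near `m` and `v m ≠ 0`.
[cite: GriffithsHarrisPrinciples1978, Ch. 1 §1 (pp. 130–131)] -/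
theorem exists_forall_eventuallyEq_pow_mul (σ : L.GlobalSection) {S' W : Set M}
    (hS' : IsPreconnected S') (hW : IsOpen W) (hS'W : S' ⊆ W) {w : M → ℂ}
    (hw : MDifferentiableOn 𝓘(ℂ, E) 𝓘(ℂ, ℂ) w W) (hw0 : ∀ m ∈ S', w m = 0)
    (hdw : ∀ m ∈ S', mfderiv 𝓘(ℂ, E) 𝓘(ℂ, ℂ) w m ≠ 0)
    (hZ : ∀ m ∈ S', ∀ᶠ x in 𝓝 m, x ∈ σ.zeroSet ↔ w x = 0) :
    ∃ N : ℕ, ∀ m ∈ S', ∀ i, m ∈ L.baseSet i → ∃ v : M → ℂ,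
      (∀ᶠ x in 𝓝 m, MDifferentiableAt 𝓘(ℂ, E) 𝓘(ℂ, ℂ) v x) ∧ v m ≠ 0 ∧
        ∀ᶠ x in 𝓝 m, σ.coord i x = w x ^ N * v x := by
  classical
  -- pointwise data along `S'`
  have hwAt : ∀ m ∈ W, ∀ᶠ x in 𝓝 m, MDifferentiableAt 𝓘(ℂ, E) 𝓘(ℂ, ℂ) w x := fun m hm ↦ by
    filter_upwards [hW.mem_nhds hm] with x hx using hw.mdifferentiableAt (hW.mem_nhds hx)
  have hσAt : ∀ i, ∀ m ∈ L.baseSet i, ∀ᶠ x in 𝓝 m, MDifferentiableAt 𝓘(ℂ, E) 𝓘(ℂ, ℂ) (σ.coord i) x :=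
    fun i m hm ↦ by
      filter_upwards [(L.isOpen_baseSet i).mem_nhds hm] with x hx
        using (σ.mdifferentiableOn_coord i).mdifferentiableAt ((L.isOpen_baseSet i).mem_nhds hx)
  have hZ' : ∀ m ∈ S', ∀ i, m ∈ L.baseSet i → ∀ᶠ x in 𝓝 m, σ.coord i x = 0 ↔ w x = 0 := fun m hm i hi ↦ by
    filter_upwards [hZ m hm, (L.isOpen_baseSet i).mem_nhds hi] with x hx hxi
    rw [← σ.mem_zeroSet_iff hxi, hx]
  have hfr : ∀ m ∈ S', ∃ᶠ x in 𝓝 m, w x ≠ 0 := fun m hm ↦ frequently_ne_zero_of_mfderiv_ne_zero (hdw m hm)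
  -- local normal forms, and the order they compute
  have hLNF : ∀ m ∈ S', ∀ i, m ∈ L.baseSet i → ∃ (N : ℕ) (v : M → ℂ),
      (∀ᶠ x in 𝓝 m, MDifferentiableAt 𝓘(ℂ, E) 𝓘(ℂ, ℂ) v x) ∧ v m ≠ 0 ∧
        (∀ᶠ x in 𝓝 m, σ.coord i x = w x ^ N * v x) ∧ orderAlong (σ.coord i) w m = N := by
    intro m hm i hi
    obtain ⟨N, v, hv, hvm, heq⟩ := exists_eventuallyEq_pow_mul_of_mfderiv_ne_zero (hσAt i m hi)
      (hwAt m (hS'W hm)) (hw0 m hm) (hdw m hm) (hZ' m hm i hi)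
    exact ⟨N, v, hv, hvm, heq, orderAlong_eq_of_eventuallyEq (hwAt m (hS'W hm)).self_of_nhds.continuousAt
      (hw0 m hm) hv.self_of_nhds.continuousAt hvm heq (hfr m hm)⟩
  -- the order in a chosen frame; it does not depend on the frame
  set idx : M → ι := fun m ↦ Classical.choose (L.exists_mem_baseSet m) with hidx
  have hidxmem : ∀ m, m ∈ L.baseSet (idx m) := fun m ↦ Classical.choose_spec (L.exists_mem_baseSet m)
  set ord : M → ℕ := fun m ↦ orderAlong (σ.coord (idx m)) w m with hord
  have hframe : ∀ m ∈ S', ∀ i, m ∈ L.baseSet i → orderAlong (σ.coord i) w m = ord m := by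
    intro m hm i hi
    obtain ⟨N, v, hv, hvm, heq, hN⟩ := hLNF m hm (idx m) (hidxmem m)
    rw [show ord m = N from hN]
    -- `σ_i = g σ_{idx}` with `g` a unit: same normal form up to a unit
    have hg : ContinuousAt (L.coordChange (idx m) i) m :=
      ((L.mdifferentiableOn_coordChange (idx m) i).mdifferentiableAt
        (((L.isOpen_baseSet _).inter (L.isOpen_baseSet i)).mem_nhds ⟨hidxmem m, hi⟩)).continuousAt
    refine orderAlong_eq_of_eventuallyEq (hwAt m (hS'W hm)).self_of_nhds.continuousAt (hw0 m hm)
      (hg.mul hv.self_of_nhds.continuousAt)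
      (mul_ne_zero (L.coordChange_ne_zero _ _ m ⟨hidxmem m, hi⟩) hvm) ?_ (hfr m hm)
    filter_upwards [heq, ((L.isOpen_baseSet _).inter (L.isOpen_baseSet i)).mem_nhds ⟨hidxmem m, hi⟩]
      with x hx hxi
    rw [σ.coord_eq_mul (idx m) i x hxi, hx, Pi.mul_apply]
    ring
  -- `ord` is locally constant along `S'`
  have hloc : ∀ m ∈ S', ∀ᶠ m' in 𝓝 m, m' ∈ S' → ord m' = ord m := by
    intro m hm
    set i := idx m with hi
    obtain ⟨N, v, hv, hvm, heq, hN⟩ := hLNF m hm i (hidxmem m)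
    have hv0 : ∀ᶠ x in 𝓝 m, v x ≠ 0 := hv.self_of_nhds.continuousAt.eventually_ne hvm
    filter_upwards [hv.eventually_nhds, hv0, heq.eventually_nhds, (L.isOpen_baseSet i).mem_nhds (hidxmem m)]
      with m' hvm' hv0m' heqm' hm'i hm'S
    rw [← hframe m' hm'S i hm'i, show ord m = N from hN]
    exact orderAlong_eq_of_eventuallyEq (hwAt m' (hS'W hm'S)).self_of_nhds.continuousAt (hw0 m' hm'S)
      hvm'.self_of_nhds.continuousAt hv0m' heqm' (hfr m' hm'S)
  have hcont : ContinuousOn ord S' := by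
    intro m hm
    refine (continuousWithinAt_const (b := ord m)).congr_of_eventuallyEq ?_ rfl
    rw [Filter.EventuallyEq, eventually_nhdsWithin_iff]
    exact hloc m hm
  -- the constant value
  refine ⟨if hne : S'.Nonempty then ord hne.some else 0, fun m hm i hi ↦ ?_⟩
  obtain ⟨N, v, hv, hvm, heq, hN⟩ := hLNF m hm i hi
  have hNe : N = (if hne : S'.Nonempty then ord hne.some else 0) := by
    rw [dif_pos ⟨m, hm⟩, ← hN, hframe m hm i hi]
    exact hS'.constant hcont hm (Nonempty.some_mem ⟨m, hm⟩)
  exact ⟨v, hv, hvm, hNe ▸ heq⟩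

end HolomorphicLineBundle.GlobalSection

end Literature.Geometry.Kaehler


/-! ## Part 2: the components of an algebraic hypersurface of `X^h` are prime divisors -/


open scoped ContDiff
open CategoryTheory AlgebraicGeometry TopologicalSpace Opposite
open Literature.AlgebraicGeometry.Motives
open Literature.AlgebraicGeometry.Motives.RatFn
open Literature.AlgebraicGeometry.Motives.AlgPoints
open Literature.NumberTheory.Transcendental
open Literature.Geometry.Kaehler

namespace Literature.AlgebraicGeometry.HodgeTheory

/-- **The components of an algebraic local hypersurface of `X^h` are prime divisors.** `X` smooth
projective of dimension `n` over `ℂ`, `φ : M → X(ℂ)` an analytification with holomorphic atlas,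
`S ⊊ M` locally of the form `{h = 0}` (`h` holomorphic), `S = (⋃ T)(ℂ)` for an irredundant finite
family `T` of closed subsets of `X`, and `Y ∈ T` irreducible, not contained in the union of the other
members. Then the generic point `η` of `Y` has codimension `1`. [cite: SerreGAGA1956, §6 Prop. 3 Cor. 3 (p. 11) and n° 20 Remarque 1]
[cite: GriffithsHarrisPrinciples1978, Ch. 1 §1] -/
theorem coheight_eq_one_of_isLocallyHypersurface {n : ℕ} {X : SchemeOver ℂ} (hX : IsSmoothProjective n X)
    [AlgebraicGeometry.IsIntegral X.left]
    {E : Type} [NormedAddCommGroup E] [NormedSpace ℂ E] [FiniteDimensional ℂ E]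
    {M : Type} [TopologicalSpace M] [ChartedSpace E M] [IsManifold 𝓘(ℂ, E) ω M]
    {φ : M → ComplexPoints X} (hφ : IsAnalytification E X n φ)
    {S : Set M} (hSuniv : S ≠ univ)
    (hS : ∀ m : M, ∃ U : Set M, IsOpen U ∧ m ∈ U ∧ ∃ h : M → ℂ,
      MDifferentiableOn 𝓘(ℂ, E) 𝓘(ℂ, ℂ) h U ∧ S ∩ U = {x ∈ U | h x = 0})
    {T : Finset (Set X.left)} (hTc : ∀ Y ∈ T, IsClosed Y)
    (hST : S = φ ⁻¹' {P | P.pt ∈ ⋃₀ (T : Set (Set X.left))})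
    {Y : Set X.left} (hY : Y ∈ T) (hYR : ¬ Y ⊆ ⋃ Y' ∈ T.erase Y, Y') {η : X.left}
    (hη : IsGenericPoint η Y) : Order.coheight η = 1 := by
  classical
  haveI := hX.smoothOfRelativeDimension
  haveI : LocallyOfFiniteType X.hom := by
    haveI : Smooth X.hom := SmoothOfRelativeDimension.smooth n _
    infer_instance
  haveI : IsManifold 𝓘(ℂ, E) 1 M := IsManifold.of_le (n := ω) le_top
  have hYc : IsClosed Y := hTc Y hY
  -- `codim η ≥ 1`: `Y ≠ X`
  have hYne : Y ≠ univ := by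
    intro hYu
    apply hSuniv
    rw [hST, eq_univ_iff_forall]
    intro m
    exact mem_sUnion.2 ⟨Y, Finset.mem_coe.2 hY, hYu ▸ mem_univ _⟩
  have h1 : ((1 : ℕ) : ℕ∞) ≤ Order.coheight η := one_le_coheight_of_mem_of_isClosed_of_ne_univ hYc hYne hη.mem
  by_contra hne
  have h2 : ((2 : ℕ) : ℕ∞) ≤ Order.coheight η := by
    have hlt : ((1 : ℕ) : ℕ∞) < Order.coheight η := lt_of_le_of_ne h1 (by exact_mod_cast (Ne.symm hne))
    have := ENat.coe_add_one_le_iff.2 hlt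
    exact_mod_cast this
  -- all points of `Y` have codimension `≥ 2`; GAGA: so do the regular points of `Y(ℂ)`
  have hcoh : ∀ z ∈ Y, ((2 : ℕ) : ℕ∞) ≤ Order.coheight z := fun z hz ↦
    h2.trans (Order.coheight_anti (Scheme.le_iff_specializes.2 (hη.specializes hz)))
  have hI2 := le_regularLocus_codim_of_le_coheight hX hφ 2 Y hYc hcoh
  -- a closed point of `Y` off the other components
  set R : Set X.left := ⋃ Y' ∈ T.erase Y, Y' with hR
  have hRc : IsClosed R := isClosed_biUnion_finset fun Y' hY' ↦ hTc Y' (Finset.mem_of_mem_erase hY')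
  obtain ⟨y₀, hy₀Y, hy₀R⟩ := not_subset.1 hYR
  haveI : JacobsonSpace X.left := LocallyOfFiniteType.jacobsonSpace X.hom
  obtain ⟨y, ⟨hyY, hyR⟩, hycl⟩ := nonempty_inter_closedPoints (⟨y₀, hy₀Y, hy₀R⟩ : (Y ∩ Rᶜ).Nonempty)
    (hYc.isLocallyClosed.inter hRc.isOpen_compl.isLocallyClosed)
  set P : ComplexPoints X := (ComplexPoints.equivClosedPoints X).symm ⟨y, hycl⟩ with hP
  have hPpt : P.pt = y := by
    have h := ComplexPoints.coe_equivClosedPoints_apply X P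
    rw [hP, Equiv.apply_symm_apply] at h
    exact h.symm
  obtain ⟨m₀, hm₀⟩ := hφ.isHomeomorph.surjective P
  -- near `m₀`, `Y(ℂ) = S`
  set A : Set M := φ ⁻¹' {Q | Q.pt ∈ Y} with hA
  have hAan : IsAnalyticSet 𝓘(ℂ, E) A := isAnalyticSet_preimage_setOf_pt_mem hφ hYc
  set N : Set M := φ ⁻¹' {Q | Q.pt ∈ ((⟨Rᶜ, hRc.isOpen_compl⟩ : X.left.Opens) : Set X.left)} with hN
  have hNo : IsOpen N := hφ.isOpen_preimage ⟨Rᶜ, hRc.isOpen_compl⟩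
  have hAN : ∀ x ∈ N, x ∈ A ↔ x ∈ S := by
    intro x hxN
    rw [hST]
    constructor
    · intro hxA
      exact mem_sUnion.2 ⟨Y, Finset.mem_coe.2 hY, hxA⟩
    · intro hxS
      obtain ⟨Y', hY', hxY'⟩ := mem_sUnion.1 hxS
      by_cases hYY' : Y' = Y
      · subst hYY'; exact hxY'
      · exact absurd (mem_biUnion (Finset.mem_erase.2 ⟨hYY', Finset.mem_coe.1 hY'⟩) hxY') hxN
  have hm₀A : m₀ ∈ A := by
    change (φ m₀).pt ∈ Y
    rw [hm₀, hPpt]; exact hyY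
  have hm₀N : m₀ ∈ N := by
    change (φ m₀).pt ∈ Rᶜ
    rw [hm₀, hPpt]; exact hyR
  obtain ⟨U₀, hU₀, hm₀U₀, h, hh, hSU₀⟩ := hS m₀
  -- a regular point `m₁` of `Y(ℂ)` in `N ∩ U₀`: codimension `≥ 2` by GAGA, `≤ 1` as a hypersurface
  have hcl : m₀ ∈ closure (regularLocus 𝓘(ℂ, E) A) :=
    IsAnalyticSet.subset_closure_regularLocus_holds (I := 𝓘(ℂ, E)) (M := M) hAan hm₀A
  obtain ⟨m₁, ⟨hm₁N, hm₁U₀⟩, hm₁A, q, hq⟩ :=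
    _root_.mem_closure_iff.1 hcl (N ∩ U₀) (hNo.inter hU₀) ⟨hm₀N, hm₀U₀⟩
  have h2q : 2 ≤ q := hI2 m₁ ⟨hm₁A, q, hq⟩ q hq
  have hZU : A ∩ (N ∩ U₀) = {x ∈ N ∩ U₀ | h x = 0} := by
    ext x
    constructor
    · rintro ⟨hxA, hxN, hxU⟩
      have hxS : x ∈ S ∩ U₀ := ⟨(hAN x hxN).1 hxA, hxU⟩
      rw [hSU₀] at hxS
      exact ⟨⟨hxN, hxU⟩, hxS.2⟩
    · rintro ⟨⟨hxN, hxU⟩, hx0⟩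
      have hxS : x ∈ S ∩ U₀ := by rw [hSU₀]; exact ⟨hxU, hx0⟩
      exact ⟨(hAN x hxN).2 hxS.1, hxN, hxU⟩
  have hq1 := codim_le_one_of_isRegularPointOfCodim_of_eq_setOf (hNo.inter hU₀)
    (hh.mono inter_subset_right) hZU ⟨hm₁N, hm₁U₀⟩ hm₁A hq
  omega

end Literature.AlgebraicGeometry.HodgeTheory


/-! ## Part 3: the divisor of a holomorphic section is algebraic (local form) -/



namespace Literature.AlgebraicGeometry.HodgeTheory

set_option backward.isDefEq.respectTransparency false in
set_option maxHeartbeats 800000 in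
/-- **The divisor of a holomorphic section is algebraic** (Serre, GAGA n° 20 Remarque 1;
Griffiths–Harris Ch. 1 §1, `L = [(s)]`), local form. Let `X` be smooth projective of dimension `n`
over `ℂ`, `φ : M → X(ℂ)` an analytification with holomorphic atlas, `L` a cocycle holomorphic line
bundle on `M` and `σ` a global holomorphic section of `L` with `{σ = 0} ≠ M`. Then there are an
effective Cartier divisor `D` on `X` and a Zariski-closed `B ⊆ X` all of whose points have codimension
`≥ 2`, such that for every chart `U_a` of `D`, every frame `U_i` of `L` and every
`m ∈ U_i ∩ φ⁻¹(U_a(ℂ))` with `φ m ∉ B(ℂ)` there is `u` holomorphic near `m`, `u m ≠ 0`, with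
`u · σ_i = F_a` near `m`, `F_a = D.sectionCoord φ _ a` the coordinate of the section `1` of `𝒪_X(D)`
(i.e. the local equation `f_a` read on `M`). [cite: SerreGAGA1956, n° 20 Remarque 1 (p. 32)]
[cite: GriffithsHarrisPrinciples1978, Ch. 1 §1 (pp. 134–136)] -/
theorem exists_cartierDivisor_localUnits {n : ℕ} {X : SchemeOver ℂ} (hX : IsSmoothProjective n X)
    [AlgebraicGeometry.IsIntegral X.left]
    {E : Type} [NormedAddCommGroup E] [NormedSpace ℂ E] [FiniteDimensional ℂ E]
    {M : Type} [TopologicalSpace M] [ChartedSpace E M] [IsManifold 𝓘(ℂ, E) ω M]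
    {φ : M → ComplexPoints X} (hφ : IsAnalytification E X n φ)
    {ι : Type*} (L : HolomorphicLineBundle ι E M) (σ : L.GlobalSection) (hσ : σ.zeroSet ≠ univ) :
    ∃ (D : CartierDivisor X.left) (hD : D.IsEffective) (B : Set X.left), IsClosed B ∧
      (∀ z ∈ B, ((2 : ℕ) : ℕ∞) ≤ Order.coheight z) ∧
      ∀ (a : D.ι) (i : ι) (m : M), m ∈ L.baseSet i → (φ m).pt ∈ D.U a → (φ m).pt ∉ B →
        ∃ u : M → ℂ, (∀ᶠ x in 𝓝 m, MDifferentiableAt 𝓘(ℂ, E) 𝓘(ℂ, ℂ) u x) ∧ u m ≠ 0 ∧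
          ∀ᶠ x in 𝓝 m, u x * σ.coord i x = D.sectionCoord φ hD.isSection_one a x := by
  classical
  -- instances
  haveI := hX.smoothOfRelativeDimension
  haveI : LocallyOfFiniteType X.hom := by
    haveI : Smooth X.hom := SmoothOfRelativeDimension.smooth n _
    infer_instance
  haveI : IsLocallyNoetherian X.left := IsSmoothProjective.isLocallyNoetherian_holds hX
  haveI : CompactSpace X.left := IsSmoothProjective.compactSpace_holds hX
  haveI : IsNoetherian X.left := {}
  haveI : NoetherianSpace X.left := inferInstance
  haveI : IsManifold 𝓘(ℂ, E) 1 M := IsManifold.of_le (n := ω) le_top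
  -- Step 1: Chow — the zero set is algebraic; its irredundant components
  set S : Set M := σ.zeroSet with hSdef
  obtain ⟨Z₀, hZ₀c, hSZ₀⟩ := chow_analyticSet_analytification_holds hX hφ S σ.isAnalyticSet_zeroSet
  obtain ⟨T, hTc, hTi, hTU, hirr⟩ := exists_finset_irredundant_components hZ₀c
  have hST : S = φ ⁻¹' {P | P.pt ∈ ⋃₀ (T : Set (Set X.left))} := by rw [hTU]; exact hSZ₀
  have hgen : ∀ Y ∈ T, ∃ η : X.left, IsGenericPoint η Y := fun Y hY ↦ QuasiSober.sober (hTi Y hY) (hTc Y hY)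
  choose! η hη using hgen
  -- `S` is locally a hypersurface, so the components are prime divisors
  have hShyp : ∀ m : M, ∃ U : Set M, IsOpen U ∧ m ∈ U ∧ ∃ h : M → ℂ,
      MDifferentiableOn 𝓘(ℂ, E) 𝓘(ℂ, ℂ) h U ∧ S ∩ U = {x ∈ U | h x = 0} := by
    intro m
    obtain ⟨i, hi⟩ := L.exists_mem_baseSet m
    refine ⟨L.baseSet i, L.isOpen_baseSet i, hi, σ.coord i, σ.mdifferentiableOn_coord i, ?_⟩
    rw [hSdef, σ.zeroSet_inter_baseSet i]
    ext x
    exact Iff.rfl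
  have hYR : ∀ Y ∈ T, ¬ Y ⊆ ⋃ Y' ∈ T.erase Y, Y' := fun Y hY h ↦
    not_subset_sUnion_erase_of_irredundant hTc hTi hirr hY (h.trans fun z hz ↦ by
      obtain ⟨Y', hY', hz'⟩ := mem_iUnion₂.1 hz
      exact mem_sUnion.2 ⟨Y', Finset.mem_coe.2 hY', hz'⟩)
  have hcoh : ∀ Y ∈ T, Order.coheight (η Y) = 1 := fun Y hY ↦
    coheight_eq_one_of_isLocallyHypersurface hX hφ hσ hShyp hTc hST hY (hYR Y hY) (hη Y hY)
  -- points of one component only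
  have honly : ∀ Y ∈ T, ∀ Y' ∈ T, η Y ∈ Y' → Y = Y' := by
    intro Y hY Y' hY' hmem
    exact hirr Y hY Y' hY' ((hη Y hY).def ▸ closure_minimal (singleton_subset_iff.2 hmem) (hTc Y' hY'))
  -- a point off `S`, hence off every component
  obtain ⟨m₀, hm₀⟩ : ∃ m₀, m₀ ∉ S := by
    by_contra h
    push Not at h
    exact hσ (eq_univ_of_forall h)
  have hm₀Y : ∀ Y ∈ T, (φ m₀).pt ∉ Y := fun Y hY hmem ↦ hm₀ (by
    rw [hST]; exact mem_sUnion.2 ⟨Y, Finset.mem_coe.2 hY, hmem⟩)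
  -- Step 2: the reduced divisors `D_k` of the components (`X` locally factorial)
  have hUFD : ∀ x : X.left, UniqueFactorizationMonoid (X.left.presheaf.stalk x) := fun x ↦
    Literature.AlgebraicGeometry.Resolution.Matsumura1987_20_3_holds _
      (isRegularLocalRing_stalk_of_smoothOfRelativeDimension X.hom n x)
  set K := ↥T with hK
  let UY : K → X.left.Opens := fun k ↦ ⟨(k : Set X.left)ᶜ, (hTc k k.2).isOpen_compl⟩
  haveI hneUY : ∀ k, Nonempty (UY k) := fun k ↦ ⟨⟨(φ m₀).pt, hm₀Y k k.2⟩⟩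
  have hcompl : ∀ k, (UY k).compl = ⟨(k : Set X.left), hTc k k.2⟩ := fun k ↦ by
    ext x
    change x ∈ ((k : Set X.left)ᶜ)ᶜ ↔ x ∈ (k : Set X.left)
    rw [compl_compl]
  have hpure : ∀ (k : K) (V : X.left.Opens) (hV : IsAffineOpen V) [Nonempty V] (P : Ideal Γ(X.left, V)),
      P ∈ ((Scheme.IdealSheafData.vanishingIdeal (UY k).compl).ideal ⟨V, hV⟩).minimalPrimes → P.height = 1 := by
    intro k V hV _ P hP
    rw [hcompl k] at hP
    exact height_eq_one_of_mem_minimalPrimes_of_isGenericPoint (hTc k k.2) (hη k k.2) (hcoh k k.2) V hV P hP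
  let Dk : K → CartierDivisor X.left := fun k ↦ ComplementDivisor.divisorOfPure hUFD (hpure k)
  have hDkE : ∀ k, (Dk k).IsEffective := fun k ↦ ComplementDivisor.isEffective_divisorOfPure hUFD (hpure k)
  -- Step 3: good charts (algebraic local equation = analytic local coordinate) and the bad set `B`
  have hchart : ∀ k : K, ∃ c : ComplementDivisor.Chart (UY k), η k ∈ c.W ∧ ∀ m : M, (φ m).pt ∈ c.W →
      (φ m).pt ∈ (k : Set X.left) → mfderiv 𝓘(ℂ, E) 𝓘(ℂ, ℂ) (fun m' ↦ evalOrZero c.W c.j (φ m')) m ≠ 0 :=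
    fun k ↦ exists_chart_mfderiv_ne_zero hX hφ (hTc k k.2) (hη k k.2) (hcoh k k.2)
  choose c hηc hdc using hchart
  set B₁ : Set X.left := ⋃ k : K, ((k : Set X.left) ∩ ((c k).W : Set X.left)ᶜ) with hB₁
  set B₂ : Set X.left := ⋃ p : {p : K × K // p.1 ≠ p.2}, ((p.1.1 : Set X.left) ∩ (p.1.2 : Set X.left)) with hB₂
  set B : Set X.left := B₁ ∪ B₂ with hB
  have hBc : IsClosed B :=
    (isClosed_iUnion_of_finite fun k : K ↦ (hTc k k.2).inter (c k).W.2.isClosed_compl).union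
      (isClosed_iUnion_of_finite fun p : {p : K × K // p.1 ≠ p.2} ↦ (hTc _ p.1.1.2).inter (hTc _ p.1.2.2))
  have hηB : ∀ k : K, η k ∉ B := by
    intro k hmem
    rcases hmem with hmem | hmem
    · obtain ⟨k', hk'⟩ := mem_iUnion.1 hmem
      have hkk' : (k : Set X.left) = k' := honly k k.2 k' k'.2 hk'.1
      have : k = k' := Subtype.ext hkk'
      subst this
      exact hk'.2 (hηc k)
    · obtain ⟨p, hp⟩ := mem_iUnion.1 hmem
      have h1 : (k : Set X.left) = p.1.1 := honly k k.2 _ p.1.1.2 hp.1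
      have h2 : (k : Set X.left) = p.1.2 := honly k k.2 _ p.1.2.2 hp.2
      exact p.2 (Subtype.ext (h1.symm.trans h2))
  have hBcoh : ∀ z ∈ B, ((2 : ℕ) : ℕ∞) ≤ Order.coheight z := by
    intro z hz
    -- `z` lies on some component `Y_k` and differs from `η_k ∉ B`
    obtain ⟨k, hzk⟩ : ∃ k : K, z ∈ (k : Set X.left) := by
      rcases hz with hz | hz
      · obtain ⟨k, hk⟩ := mem_iUnion.1 hz; exact ⟨k, hk.1⟩
      · obtain ⟨p, hp⟩ := mem_iUnion.1 hz; exact ⟨p.1.1, hp.1⟩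
    have hne : η k ≠ z := fun h ↦ hηB k (h ▸ hz)
    have h1 : ((1 : ℕ) : ℕ∞) ≤ Order.coheight (η k) := by rw [hcoh k k.2]; exact_mod_cast le_rfl
    exact add_one_le_coheight_of_specializes_of_ne ((hη k k.2).specializes hzk) hne h1
  -- Step 4: on each component, off `B`: the smooth connected piece `S_k` and the local coordinate `w_k`
  let w : K → M → ℂ := fun k m ↦ evalOrZero (c k).W (c k).j (φ m)
  set Wk : K → Set M := fun k ↦ φ ⁻¹' {P | P.pt ∈ (c k).W} with hWk
  have hWko : ∀ k, IsOpen (Wk k) := fun k ↦ hφ.isOpen_preimage (c k).W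
  have hw : ∀ k, MDifferentiableOn 𝓘(ℂ, E) 𝓘(ℂ, ℂ) (w k) (Wk k) := fun k ↦
    IsAnalytification.mdifferentiableOn_evalOrZero_opens_holds hφ (c k).W (c k).j
  set Sk : K → Set M := fun k ↦ {m | (φ m).pt ∈ (k : Set X.left) ∧ (φ m).pt ∉ B} with hSk
  have hSkW : ∀ k, Sk k ⊆ Wk k := by
    intro k m hm
    by_contra hW
    exact hm.2 (Or.inl (mem_iUnion.2 ⟨k, hm.1, hW⟩))
  have hSk_only : ∀ k, ∀ m ∈ Sk k, ∀ k' : K, k' ≠ k → (φ m).pt ∉ (k' : Set X.left) := by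
    intro k m hm k' hk' hmem
    exact hm.2 (Or.inr (mem_iUnion.2 ⟨⟨(k', k), hk'⟩, hmem, hm.1⟩))
  have hw_zero_iff : ∀ k, ∀ m ∈ Wk k, w k m = 0 ↔ (φ m).pt ∈ (k : Set X.left) := by
    intro k m hm
    rw [evalOrZero_chart_eq_zero_iff (c k) hm]
    change (φ m).pt ∉ (k : Set X.left)ᶜ ↔ _
    rw [notMem_compl_iff]
  have hw0 : ∀ k, ∀ m ∈ Sk k, w k m = 0 := fun k m hm ↦ (hw_zero_iff k m (hSkW k hm)).2 hm.1
  have hdw : ∀ k, ∀ m ∈ Sk k, mfderiv 𝓘(ℂ, E) 𝓘(ℂ, ℂ) (w k) m ≠ 0 := fun k m hm ↦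
    hdc k m (hSkW k hm) hm.1
  -- near a point of `S_k`, `{σ = 0} = {w_k = 0}`
  have hZk : ∀ k, ∀ m ∈ Sk k, ∀ᶠ x in 𝓝 m, x ∈ S ↔ w k x = 0 := by
    intro k m hm
    set R : Set X.left := ⋃ k' ∈ (Finset.univ : Finset K).erase k, (k' : Set X.left) with hR
    have hRc : IsClosed R := isClosed_biUnion_finset fun k' _ ↦ hTc k' k'.2
    have hmR : (φ m).pt ∉ R := by
      intro hmem
      obtain ⟨k', hk', hmem'⟩ := mem_iUnion₂.1 hmem
      exact hSk_only k m hm k' (Finset.mem_erase.1 hk').1 hmem'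
    filter_upwards [(hWko k).mem_nhds (hSkW k hm),
      (hφ.isOpen_preimage ⟨Rᶜ, hRc.isOpen_compl⟩).mem_nhds (show m ∈ φ ⁻¹' {P | P.pt ∈ Rᶜ} from hmR)]
      with x hxW hxR
    rw [hw_zero_iff k x hxW, hST]
    constructor
    · intro hxS
      obtain ⟨Y', hY', hxY'⟩ := mem_sUnion.1 hxS
      by_cases hYk : Y' = k
      · rw [← hYk]; exact hxY'
      · exact absurd (mem_iUnion₂.2 ⟨⟨Y', Finset.mem_coe.1 hY'⟩, Finset.mem_erase.2
          ⟨fun h ↦ hYk (congrArg Subtype.val h), Finset.mem_univ _⟩, hxY'⟩) hxR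
    · intro hxk
      exact mem_sUnion.2 ⟨k, k.2, hxk⟩
  -- `S_k` is preconnected (an open part of the irreducible `Y_k`, in the complex topology)
  have hSkconn : ∀ k, IsPreconnected (Sk k) := by
    intro k
    have hconn := ComplexPoints.isConnected_setOf_pt_mem_inter_of_isIrreducible X (hTc k k.2) (hTi k k.2)
      ⟨Bᶜ, hBc.isOpen_compl⟩ ⟨η k, (hη k k.2).mem, hηB k⟩
    have hpre : Sk k = hφ.homeomorph ⁻¹' {P : ComplexPoints X | P.pt ∈ (k : Set X.left) ∧
        P.pt ∈ ((⟨Bᶜ, hBc.isOpen_compl⟩ : X.left.Opens) : Set X.left)} := rfl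
    rw [hpre, Homeomorph.isPreconnected_preimage]
    exact hconn.isPreconnected
  -- Step 5: the orders `N k` of `σ` along `S_k`, and the divisor `D = Σ N_k D_k`
  have horder : ∀ k, ∃ N : ℕ, ∀ m ∈ Sk k, ∀ i, m ∈ L.baseSet i → ∃ v : M → ℂ,
      (∀ᶠ x in 𝓝 m, MDifferentiableAt 𝓘(ℂ, E) 𝓘(ℂ, ℂ) v x) ∧ v m ≠ 0 ∧
        ∀ᶠ x in 𝓝 m, σ.coord i x = w k x ^ N * v x := fun k ↦
    σ.exists_forall_eventuallyEq_pow_mul (hSkconn k) (hWko k) (hSkW k) (hw k) (hw0 k) (hdw k) (hZk k)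
  choose N hN using horder
  set D : CartierDivisor X.left := CartierDivisor.finprod Dk N with hDdef
  have hD : D.IsEffective := CartierDivisor.isEffective_finprod N hDkE
  refine ⟨D, hD, B, hBc, hBcoh, fun a i m hmi hma hmB ↦ ?_⟩
  -- Step 6: the local unit at `m`
  have hmk : ∀ k, (φ m).pt ∈ ((a k).W : Set X.left) := fun k ↦
    (CartierDivisor.mem_finprod_U_iff Dk N a _).1 hma k
  -- the factors `F_k = (j_{a_k} · 1)(φ ·)` of `F_a`
  set Fk : K → M → ℂ := fun k ↦ (Dk k).sectionCoord φ (hDkE k).isSection_one (a k) with hFk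
  have hFk_hol : ∀ k, ∀ᶠ x in 𝓝 m, MDifferentiableAt 𝓘(ℂ, E) 𝓘(ℂ, ℂ) (Fk k) x := by
    intro k
    have hopen : IsOpen (φ ⁻¹' {P | P.pt ∈ (Dk k).U (a k)}) := hφ.isOpen_preimage _
    filter_upwards [hopen.mem_nhds (show m ∈ φ ⁻¹' {P | P.pt ∈ (Dk k).U (a k)} from hmk k)] with x hx
    exact (mdifferentiableOn_sectionCoord hφ (hDkE k).isSection_one (a k)).mdifferentiableAt (hopen.mem_nhds hx)
  have hFk_ne : ∀ k, ∀ x : M, (φ x).pt ∈ ((a k).W : Set X.left) → (φ x).pt ∉ (k : Set X.left) → Fk k x ≠ 0 := by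
    intro k x hxW hxk
    refine sectionCoord_ne_zero (hDkE k).isSection_one hxW ?_
    rw [(Dk k).mem_nonvanishing_iff hxW, mul_one]
    exact ((a k).isUnitAt_iff hxW).2 hxk
  -- product formula for `F_a` near `m`
  have hUa : IsOpen (φ ⁻¹' {P | P.pt ∈ D.U a}) := hφ.isOpen_preimage _
  have hF : ∀ᶠ x in 𝓝 m, D.sectionCoord φ hD.isSection_one a x = ∏ k, Fk k x ^ N k := by
    filter_upwards [hUa.mem_nhds (show m ∈ φ ⁻¹' {P | P.pt ∈ D.U a} from hma)] with x hx
    exact sectionCoord_finprod Dk N hDkE a hx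
  have hF_hol : ∀ᶠ x in 𝓝 m, MDifferentiableAt 𝓘(ℂ, E) 𝓘(ℂ, ℂ) (D.sectionCoord φ hD.isSection_one a) x := by
    filter_upwards [hUa.mem_nhds (show m ∈ φ ⁻¹' {P | P.pt ∈ D.U a} from hma)] with x hx
    exact (mdifferentiableOn_sectionCoord hφ hD.isSection_one a).mdifferentiableAt (hUa.mem_nhds hx)
  have hσ_hol : ∀ᶠ x in 𝓝 m, MDifferentiableAt 𝓘(ℂ, E) 𝓘(ℂ, ℂ) (σ.coord i) x := by
    filter_upwards [(L.isOpen_baseSet i).mem_nhds hmi] with x hx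
    exact (σ.mdifferentiableOn_coord i).mdifferentiableAt ((L.isOpen_baseSet i).mem_nhds hx)
  by_cases hmS : m ∈ S
  · -- `m ∈ S_k` for the unique component `Y_k` through `φ m`
    obtain ⟨Y, hY, hmY⟩ : ∃ Y ∈ T, (φ m).pt ∈ Y := by
      have : m ∈ φ ⁻¹' {P | P.pt ∈ ⋃₀ (T : Set (Set X.left))} := hST ▸ hmS
      obtain ⟨Y, hY, hmY⟩ := mem_sUnion.1 this
      exact ⟨Y, Finset.mem_coe.1 hY, hmY⟩
    set k : K := ⟨Y, hY⟩ with hk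
    have hmSk : m ∈ Sk k := ⟨hmY, hmB⟩
    obtain ⟨vσ, hvσ, hvσm, hσeq⟩ := hN k m hmSk i hmi
    -- `F_k = t · w_k` near `m`, `t` the transition unit of `D_k` between the charts `a k` and `c k`
    set t : M → ℂ := fun x ↦ evalOrZero ((Dk k).U (a k) ⊓ (Dk k).U (c k)) ((Dk k).transFun (a k) (c k)) (φ x)
      with ht
    have hmck : (φ m).pt ∈ ((c k).W : Set X.left) := hSkW k hmSk
    have hopen : IsOpen (φ ⁻¹' {P | P.pt ∈ (Dk k).U (a k) ⊓ (Dk k).U (c k)}) := hφ.isOpen_preimage _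
    have hmem : m ∈ φ ⁻¹' {P | P.pt ∈ (Dk k).U (a k) ⊓ (Dk k).U (c k)} := ⟨hmk k, hmck⟩
    have ht_hol : ∀ᶠ x in 𝓝 m, MDifferentiableAt 𝓘(ℂ, E) 𝓘(ℂ, ℂ) t x := by
      filter_upwards [hopen.mem_nhds hmem] with x hx
      exact (IsAnalytification.mdifferentiableOn_evalOrZero_opens_holds hφ _ _).mdifferentiableAt (hopen.mem_nhds hx)
    have htm : t m ≠ 0 := left_ne_zero_of_mul_eq_one ((Dk k).evalOrZero_transFun_mul_symm (hmk k) hmck)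
    have hFkt : ∀ᶠ x in 𝓝 m, Fk k x = t x * w k x := by
      filter_upwards [hopen.mem_nhds hmem] with x hx
      rw [hFk]
      change (Dk k).sectionCoord φ (hDkE k).isSection_one (a k) x = _
      rw [sectionCoord_eq_mul (hDkE k).isSection_one hx.2 hx.1, sectionCoord_divisorOfPure hUFD (hpure k) (c k) hx.2]
    -- the other factors do not vanish at `m`
    have hother : ∀ k' ∈ (Finset.univ : Finset K).erase k, Fk k' m ≠ 0 := fun k' hk' ↦
      hFk_ne k' m (hmk k') (hSk_only k m hmSk k' (Finset.mem_erase.1 hk').1)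
    -- `F_a = w_k ^ N_k · v_F`
    set vF : M → ℂ := fun x ↦ t x ^ N k * ∏ k' ∈ (Finset.univ : Finset K).erase k, Fk k' x ^ N k' with hvF
    have hvF_hol : ∀ᶠ x in 𝓝 m, MDifferentiableAt 𝓘(ℂ, E) 𝓘(ℂ, ℂ) vF x := by
      have hall : ∀ᶠ x in 𝓝 m, ∀ k', MDifferentiableAt 𝓘(ℂ, E) 𝓘(ℂ, ℂ) (Fk k') x :=
        eventually_all.2 fun k' ↦ hFk_hol k'
      have hfun : (fun x ↦ ∏ k' ∈ (Finset.univ : Finset K).erase k, Fk k' x ^ N k') =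
          ∏ k' ∈ (Finset.univ : Finset K).erase k, fun x ↦ Fk k' x ^ N k' := by
        ext x
        simp only [Finset.prod_apply]
      filter_upwards [ht_hol, hall] with x htx hx
      refine (htx.pow _).mul ?_
      rw [hfun]
      exact MDifferentiableAt.prod fun k' _ ↦ (hx k').pow _
    have hvFm : vF m ≠ 0 := mul_ne_zero (pow_ne_zero _ htm)
      (Finset.prod_ne_zero_iff.2 fun k' hk' ↦ pow_ne_zero _ (hother k' hk'))
    have hFeq : ∀ᶠ x in 𝓝 m, D.sectionCoord φ hD.isSection_one a x = w k x ^ N k * vF x := by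
      filter_upwards [hF, hFkt] with x hx hxt
      rw [hx, ← Finset.mul_prod_erase _ _ (Finset.mem_univ k), hxt, hvF]
      ring
    exact exists_unit_of_eventuallyEq_pow_mul hvσ hvσm hσeq hvF_hol hvFm hFeq
  · -- `m ∉ S`: `u = F_a / σ_i`
    have hσm : σ.coord i m ≠ 0 := fun h0 ↦ hmS ((σ.mem_zeroSet_iff hmi).2 h0)
    have hmY : ∀ k : K, (φ m).pt ∉ (k : Set X.left) := fun k hmem ↦ hmS (by
      rw [hST]; exact mem_sUnion.2 ⟨k, k.2, hmem⟩)
    have hσ0 : ∀ᶠ x in 𝓝 m, σ.coord i x ≠ 0 := hσ_hol.self_of_nhds.continuousAt.eventually_ne hσm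
    refine ⟨fun x ↦ D.sectionCoord φ hD.isSection_one a x / σ.coord i x, ?_, ?_, ?_⟩
    · filter_upwards [hF_hol.eventually_nhds, hσ_hol.eventually_nhds, hσ0.eventually_nhds] with x hFx hσx h0x
      exact hFx.self_of_nhds.div hσx.self_of_nhds h0x.self_of_nhds
    · refine div_ne_zero ?_ hσm
      rw [hF.self_of_nhds]
      exact Finset.prod_ne_zero_iff.2 fun k _ ↦ pow_ne_zero _ (hFk_ne k m (hmk k) (hmY k))
    · filter_upwards [hσ0] with x hx
      exact div_mul_cancel₀ _ hx

end Literature.AlgebraicGeometry.HodgeTheory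


/-! ## Part 4: `L ≅ 𝒪_X((σ))^an`, and Prop. 18 for line bundles from meromorphic sections -/



/-! ### Two small tools: identities by density, `1 × 1` matrices -/

namespace Literature.Geometry.Kaehler

/-- **Identity principle by density**: two functions continuous on an open set `O` which agree at
the points of `O` satisfying a property `p` that holds frequently near every point of `O` agree on
`O`. [folklore] -/
theorem eqOn_of_frequently_of_continuousOn {M : Type*} [TopologicalSpace M] {f g : M → ℂ}
    {O : Set M} (hO : IsOpen O) (hf : ContinuousOn f O) (hg : ContinuousOn g O) {p : M → Prop}
    (hp : ∀ x ∈ O, ∃ᶠ y in 𝓝 x, p y) (hfg : ∀ y ∈ O, p y → f y = g y) : EqOn f g O := by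
  intro x hx
  have hfr : ∃ᶠ y in 𝓝 x, f y = g y :=
    ((hp x hx).and_eventually (hO.mem_nhds hx)).mono fun y ⟨hy, hyO⟩ ↦ hfg y hyO hy
  exact tendsto_nhds_unique_of_frequently_eq (hf.continuousAt (hO.mem_nhds hx))
    (hg.continuousAt (hO.mem_nhds hx)) hfr

/-- Product of two constant `1 × 1` matrices. [folklore] -/
theorem matrix_of_const_mul_of_const (a b : ℂ) :
    ((Matrix.of fun (_ : Fin 1) (_ : Fin 1) ↦ a) * Matrix.of fun (_ : Fin 1) (_ : Fin 1) ↦ b) =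
      Matrix.of fun _ _ ↦ a * b := by
  ext p q
  simp [Matrix.mul_apply]

namespace SmoothComplexVectorBundle

variable {ι : Type*} {E : Type*} [NormedAddCommGroup E] [NormedSpace ℂ E]
  {M : Type*} [TopologicalSpace M] [ChartedSpace E M]

/-- **A holomorphic rank-one cocycle as a holomorphic line bundle** (Voisin's convention
`σ_i = g_ij σ_j`, i.e. `g_ij = (V.coordChange j i) 0 0`, inverse to `HolomorphicLineBundle.toSmoothCocycle`).
[cite: Kobayashi1987, Ch. I §1 (1.15)] -/
def toHolomorphicLineBundle (V : SmoothComplexVectorBundle ι E M 1) (hV : V.IsHolomorphic) :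
    HolomorphicLineBundle ι E M where
  baseSet := V.baseSet
  isOpen_baseSet := V.isOpen_baseSet
  exists_mem_baseSet := V.exists_mem_baseSet
  coordChange i j x := V.coordChange j i x 0 0
  mdifferentiableOn_coordChange i j := (hV j i 0 0).mono fun _ hx ↦ ⟨hx.2, hx.1⟩
  coordChange_ne_zero i j x hx h0 := by
    have h := V.coordChange_mul_symm j i hx.2 hx.1
    have h' := congrFun (congrFun h 0) 0
    rw [Matrix.mul_apply, Fin.sum_univ_one, h0, zero_mul, Matrix.one_apply_eq] at h'
    exact zero_ne_one h'
  coordChange_comp i j k x hx := by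
    have h := V.coordChange_comp k j i x ⟨⟨hx.2, hx.1.2⟩, hx.1.1⟩
    have h' := congrFun (congrFun h 0) 0
    rw [Matrix.mul_apply, Fin.sum_univ_one] at h'
    rw [mul_comm]
    exact h'

/-- The base sets of `V.toHolomorphicLineBundle hV` are those of `V` (definitional). [folklore] -/
@[simp]
theorem toHolomorphicLineBundle_baseSet (V : SmoothComplexVectorBundle ι E M 1) (hV : V.IsHolomorphic)
    (i : ι) : (V.toHolomorphicLineBundle hV).baseSet i = V.baseSet i :=
  rfl

/-- The transition functions of `V.toHolomorphicLineBundle hV` (definitional). [folklore] -/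
@[simp]
theorem toHolomorphicLineBundle_coordChange (V : SmoothComplexVectorBundle ι E M 1) (hV : V.IsHolomorphic)
    (i j : ι) (x : M) : (V.toHolomorphicLineBundle hV).coordChange i j x = V.coordChange j i x 0 0 :=
  rfl

/-- **A holomorphic rank-one cocycle is analytically equivalent to (the cocycle of) its holomorphic
line bundle.** [cite: FritzscheGrauert2002, Ch. IV §2 (Equivalence)] -/
theorem analyticallyEquivalent_toHolomorphicLineBundle [FiniteDimensional ℂ E]
    [IsManifold 𝓘(ℂ, E) ω M] [IsManifold 𝓘(ℝ, E) ∞ M] (V : SmoothComplexVectorBundle ι E M 1)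
    (hV : V.IsHolomorphic) :
    AnalyticallyEquivalent V (V.toHolomorphicLineBundle hV).toSmoothCocycle :=
  analyticallyEquivalent_of_coordChange_eq (fun _ ↦ rfl) (fun i j x _ ↦ by
    ext p q
    rw [HolomorphicLineBundle.toSmoothCocycle_coordChange_apply, toHolomorphicLineBundle_coordChange,
      Subsingleton.elim p 0, Subsingleton.elim q 0])
    (HolomorphicLineBundle.toSmoothCocycle_isHolomorphic _)

end SmoothComplexVectorBundle

end Literature.Geometry.Kaehler

/-! ### The difference of two Cartier divisors (`CartierDivisor.sub`, from `CartierDivisorBlowupExcess`) -/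

namespace Literature.AlgebraicGeometry.HodgeTheory

section Sub

variable {X : SchemeOver ℂ} [AlgebraicGeometry.IsIntegral X.left]

/-- **The transition functions of `𝒪_X(D₁ - D₂)` at complex points**: on `U_a ∩ V_b ∩ U_{a'} ∩ V_{b'}`,
`(f_a/g_b)/(f_{a'}/g_{b'}) = (f_a/f_{a'}) · (g_{b'}/g_b)`, evaluated at a complex point.
[cite: GortzWedhorn2020, Section (11.9) (p. 374)] -/
theorem evalOrZero_transFun_sub (D₁ D₂ : CartierDivisor X.left) (P : ComplexPoints X)
    {a a' : D₁.ι} {b b' : D₂.ι} (ha : P.pt ∈ D₁.U a) (ha' : P.pt ∈ D₁.U a') (hb : P.pt ∈ D₂.U b)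
    (hb' : P.pt ∈ D₂.U b') :
    evalOrZero ((D₁.sub D₂).U (a, b) ⊓ (D₁.sub D₂).U (a', b')) ((D₁.sub D₂).transFun (a, b) (a', b')) P =
      evalOrZero (D₁.U a ⊓ D₁.U a') (D₁.transFun a a') P *
        evalOrZero (D₂.U b' ⊓ D₂.U b) (D₂.transFun b' b) P := by
  have hW : P.pt ∈ (D₁.sub D₂).U (a, b) ⊓ (D₁.sub D₂).U (a', b') := ⟨⟨ha, hb⟩, ha', hb'⟩
  have h1 : (D₁.sub D₂).U (a, b) ⊓ (D₁.sub D₂).U (a', b') ≤ D₁.U a ⊓ D₁.U a' :=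
    fun x hx ↦ ⟨hx.1.1, hx.2.1⟩
  have h2 : (D₁.sub D₂).U (a, b) ⊓ (D₁.sub D₂).U (a', b') ≤ D₂.U b' ⊓ D₂.U b :=
    fun x hx ↦ ⟨hx.2.2, hx.1.2⟩
  rw [← evalOrZero_map_homOfLE h1 _ hW, ← evalOrZero_map_homOfLE h2 _ hW, evalOrZero_of_mem _ hW,
    evalOrZero_of_mem _ hW, evalOrZero_of_mem _ hW, ← AlgPoints.evalRingHom_apply,
    ← AlgPoints.evalRingHom_apply, ← AlgPoints.evalRingHom_apply, ← map_mul]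
  congr 1
  refine section_ext fun h ↦ ?_
  simp only [CartierDivisor.ofSection_transFun, map_mul, ofSection_map]
  change D₁.f a / D₂.f b / (D₁.f a' / D₂.f b') = D₁.f a / D₁.f a' * (D₂.f b' / D₂.f b)
  have h1a := D₁.f_ne_zero a
  have h1a' := D₁.f_ne_zero a'
  have h2b := D₂.f_ne_zero b
  have h2b' := D₂.f_ne_zero b'
  field_simp

variable {n : ℕ} {E : Type*} [NormedAddCommGroup E] [NormedSpace ℂ E] [FiniteDimensional ℂ E]
  {M : Type*} [TopologicalSpace M] [ChartedSpace E M] [IsManifold 𝓘(ℂ, E) ω M]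
  [IsManifold 𝓘(ℝ, E) ∞ M] {φ : M → ComplexPoints X} (hφ : IsAnalytification E X n φ)

/-- **`L ⊗ 𝒪_X(D₂)^an ≅ 𝒪_X(D₁)^an` holomorphically implies `L ≅ 𝒪_X(D₁ - D₂)^an` holomorphically**
(matrices `Ψ_{(a,b), i} = Φ_{a, (i,b)}`; condition (C) of Fritzsche–Grauert IV §2 from that of `Φ`,
the transition functions of `𝒪_X(D₁ - D₂)` being `(f_a/f_{a'})(g_{b'}/g_b)`).
[cite: FritzscheGrauert2002, Ch. IV §2 (C)] [cite: GortzWedhorn2020, Section (11.9) (p. 374)] -/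
theorem analyticallyEquivalent_cartierDivisorCocycle_sub {ι : Type*} (L : HolomorphicLineBundle ι E M)
    (D₁ D₂ : CartierDivisor X.left)
    (h : SmoothComplexVectorBundle.AnalyticallyEquivalent
      (L.tensor (cartierDivisorLineBundle hφ D₂)).toSmoothCocycle (cartierDivisorCocycle hφ D₁)) :
    SmoothComplexVectorBundle.AnalyticallyEquivalent L.toSmoothCocycle
      (cartierDivisorCocycle hφ (D₁.sub D₂)) := by
  obtain ⟨Φ, hΦ⟩ := h
  refine ⟨⟨fun p i x ↦ Φ.map p.1 (i, p.2) x, fun p i x hx ↦ Φ.isUnit_map p.1 (i, p.2) x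
    ⟨⟨hx.1, hx.2.2⟩, hx.2.1⟩, fun p q i j x hx ↦ ?_⟩, fun p i r r' ↦
      (hΦ p.1 (i, p.2) r r').mono fun x hx ↦ ⟨⟨hx.1, hx.2.2⟩, hx.2.1⟩⟩
  obtain ⟨⟨hi, hj⟩, ⟨hp1, hp2⟩, ⟨hq1, hq2⟩⟩ := hx
  have hC := Φ.map_mul_coordChange p.1 q.1 (i, p.2) (j, q.2) x ⟨⟨⟨hi, hp2⟩, ⟨hj, hq2⟩⟩, ⟨hp1, hq1⟩⟩
  have hC00 := congrFun (congrFun hC 0) 0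
  simp only [Matrix.mul_apply, Fin.sum_univ_one, HolomorphicLineBundle.toSmoothCocycle_coordChange_apply,
    HolomorphicLineBundle.tensor_coordChange_apply] at hC00
  have hss' := D₂.evalOrZero_transFun_mul_symm (P := φ x) hp2 hq2
  ext r r'
  rw [Subsingleton.elim r 0, Subsingleton.elim r' 0]
  simp only [Matrix.mul_apply, Fin.sum_univ_one, HolomorphicLineBundle.toSmoothCocycle_coordChange_apply]
  change Φ.map p.1 (i, p.2) x 0 0 * L.coordChange j i x =
    evalOrZero ((D₁.sub D₂).U p ⊓ (D₁.sub D₂).U q) ((D₁.sub D₂).transFun p q) (φ x) * Φ.map q.1 (j, q.2) x 0 0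
  rw [show p = (p.1, p.2) from rfl, show q = (q.1, q.2) from rfl,
    evalOrZero_transFun_sub D₁ D₂ (φ x) hp1 hq1 hp2 hq2]
  change Φ.map p.1 (i, p.2) x 0 0 * (L.coordChange j i x * evalOrZero (D₂.U p.2 ⊓ D₂.U q.2)
      (D₂.transFun p.2 q.2) (φ x)) =
    evalOrZero (D₁.U p.1 ⊓ D₁.U q.1) (D₁.transFun p.1 q.1) (φ x) * Φ.map q.1 (j, q.2) x 0 0 at hC00
  linear_combination (evalOrZero (D₂.U q.2 ⊓ D₂.U p.2) (D₂.transFun q.2 p.2) (φ x)) * hC00 -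
    (Φ.map p.1 (i, p.2) x 0 0 * L.coordChange j i x) * hss'

end Sub

/-! ### GAGA for line bundles with a section -/

set_option maxHeartbeats 800000 in
/-- **GAGA for holomorphic line bundles with a section** (Serre, GAGA n° 20 Remarque 1;
Griffiths–Harris Ch. 1 §1, `L = [(s)]`). Let `X` be smooth projective of dimension `n` over `ℂ`,
`φ : M → X(ℂ)` an analytification with holomorphic atlas, `L` a cocycle holomorphic line bundle on `M`
with a global holomorphic section `σ` such that `{σ = 0} ≠ M`. Then for the effective algebraic Cartier
divisor `D = (σ)` on `X`, the cocycle of `L` is holomorphically isomorphic to `𝒪_X(D)^an`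
(`cartierDivisorCocycle`). [cite: SerreGAGA1956, n° 20 Remarque 1 (p. 32)]
[cite: GriffithsHarrisPrinciples1978, Ch. 1 §1 (p. 136)] [cite: FritzscheGrauert2002, Ch. III Thm. 6.12 and Ch. IV §2] -/
theorem analyticallyEquivalent_cartierDivisorCocycle_of_globalSection {n : ℕ} {X : SchemeOver ℂ}
    (hX : IsSmoothProjective n X) [AlgebraicGeometry.IsIntegral X.left]
    {E : Type} [NormedAddCommGroup E] [NormedSpace ℂ E] [FiniteDimensional ℂ E]
    {M : Type} [TopologicalSpace M] [ChartedSpace E M] [IsManifold 𝓘(ℂ, E) ω M]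
    [IsManifold 𝓘(ℝ, E) ∞ M]
    {φ : M → ComplexPoints X} (hφ : IsAnalytification E X n φ)
    {ι : Type*} (L : HolomorphicLineBundle ι E M) (σ : L.GlobalSection) (hσ : σ.zeroSet ≠ univ) :
    ∃ D : CartierDivisor X.left, D.IsEffective ∧
      SmoothComplexVectorBundle.AnalyticallyEquivalent L.toSmoothCocycle (cartierDivisorCocycle hφ D) := by
  classical
  haveI := hX.smoothOfRelativeDimension
  haveI : LocallyOfFiniteType X.hom := by
    haveI : Smooth X.hom := SmoothOfRelativeDimension.smooth n _
    infer_instance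
  haveI : IsManifold 𝓘(ℂ, E) 1 M := IsManifold.of_le (n := ω) le_top
  obtain ⟨D, hD, B, hBc, hBcoh, hKLC⟩ := exists_cartierDivisor_localUnits hX hφ L σ hσ
  refine ⟨D, hD, ?_⟩
  -- `M` is connected, so `{σ_i ≠ 0}` is dense in `U_i`
  haveI : ConnectedSpace M := by
    have h := ComplexPoints.isConnected_setOf_pt_mem_of_isIrreducible_holds X isClosed_univ
      (IrreducibleSpace.isIrreducible_univ X.left)
    have h2 := hφ.homeomorph.isConnected_preimage.2 h
    have h3 : (hφ.homeomorph ⁻¹' {P : ComplexPoints X | P.pt ∈ (univ : Set X.left)}) = univ :=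
      eq_univ_of_forall fun _ ↦ mem_univ _
    rw [h3] at h2
    exact connectedSpace_iff_univ.2 h2
  have hSint : interior σ.zeroSet = ∅ :=
    IsAnalyticSet.interior_eq_empty_holds 𝓘(ℂ, E) M σ.isAnalyticSet_zeroSet hσ
  have hfreq : ∀ i, ∀ x ∈ L.baseSet i, ∃ᶠ y in 𝓝 x, σ.coord i y ≠ 0 := by
    intro i x hx
    by_contra hcon
    rw [Filter.not_frequently] at hcon
    simp only [not_not] at hcon
    have hev : ∀ᶠ y in 𝓝 x, y ∈ σ.zeroSet := by
      filter_upwards [hcon, (L.isOpen_baseSet i).mem_nhds hx] with y hy hyi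
      exact (σ.mem_zeroSet_iff hyi).2 hy
    have : x ∈ interior σ.zeroSet := mem_interior_iff_mem_nhds.2 hev
    rw [hSint] at this
    exact this
  -- the exceptional analytic set `A = φ⁻¹(B(ℂ))`, of codimension `≥ 2`
  set A : Set M := φ ⁻¹' {P | P.pt ∈ B} with hA
  have hAan : IsAnalyticSet 𝓘(ℂ, E) A := isAnalyticSet_preimage_setOf_pt_mem hφ hBc
  have hAc : IsOpen Aᶜ := hφ.isOpen_preimage ⟨Bᶜ, hBc.isOpen_compl⟩
  have hcodim : ∀ z c, z ∈ A → IsRegularPointOfCodim 𝓘(ℂ, E) A c z → 2 ≤ c := fun z c hz hreg ↦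
    le_regularLocus_codim_of_le_coheight hX hφ 2 B hBc hBcoh z ⟨hz, c, hreg⟩ c hreg
  -- notation: local equations `F_a` on `V_a = φ⁻¹(U_a(ℂ))`, overlaps `G_{a i} = U_i ∩ V_a`
  set F : D.ι → M → ℂ := fun a ↦ D.sectionCoord φ hD.isSection_one a with hF
  set Va : D.ι → Set M := fun a ↦ φ ⁻¹' {P | P.pt ∈ D.U a} with hVa
  have hVao : ∀ a, IsOpen (Va a) := fun a ↦ hφ.isOpen_preimage _
  have hF_hol : ∀ a, MDifferentiableOn 𝓘(ℂ, E) 𝓘(ℂ, ℂ) (F a) (Va a) := fun a ↦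
    mdifferentiableOn_sectionCoord hφ hD.isSection_one a
  set G : D.ι → ι → Set M := fun a i ↦ L.baseSet i ∩ Va a with hG
  have hGo : ∀ a i, IsOpen (G a i) := fun a i ↦ (L.isOpen_baseSet i).inter (hVao a)
  -- Step 1: the unit `λ_{a i}` off `A`, glued from the local units
  choose! u hu_hol hu_ne hu_eq using hKLC
  set lam : D.ι → ι → M → ℂ := fun a i m ↦ u a i m m with hlam
  have hkey : ∀ a i, ∀ m ∈ G a i, m ∉ A → ∀ᶠ m' in 𝓝 m, lam a i m' = u a i m m' := by
    intro a i m hm hmA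
    have h1 := hu_hol a i m hm.1 hm.2 hmA
    have h3 := hu_eq a i m hm.1 hm.2 hmA
    filter_upwards [h1.eventually_nhds, h3.eventually_nhds, (hGo a i).mem_nhds hm, hAc.mem_nhds hmA]
      with m' h1' h3' hm' hm'A
    have g1 := hu_hol a i m' hm'.1 hm'.2 hm'A
    have g3 := hu_eq a i m' hm'.1 hm'.2 hm'A
    have hfr : ∃ᶠ y in 𝓝 m', u a i m' y = u a i m y := by
      have hev : ∀ᶠ y in 𝓝 m', σ.coord i y ≠ 0 → u a i m' y = u a i m y := by
        filter_upwards [g3, h3'] with y hy1 hy2 hσy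
        exact mul_right_cancel₀ hσy (hy1.trans hy2.symm)
      exact ((hfreq i m' hm'.1).and_eventually hev).mono fun y ⟨hy, himp⟩ ↦ himp hy
    exact tendsto_nhds_unique_of_frequently_eq g1.self_of_nhds.continuousAt
      h1'.self_of_nhds.continuousAt hfr
  have hlam_hol : ∀ a i, MDifferentiableOn 𝓘(ℂ, E) 𝓘(ℂ, ℂ) (lam a i) (G a i \ A) := by
    intro a i m hm
    have h1 := hu_hol a i m hm.1.1 hm.1.2 hm.2
    exact (h1.self_of_nhds.congr_of_eventuallyEq (hkey a i m hm.1 hm.2)).mdifferentiableWithinAt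
  have hlam_ne : ∀ a i, ∀ m ∈ G a i, m ∉ A → lam a i m ≠ 0 := fun a i m hm hmA ↦
    hu_ne a i m hm.1 hm.2 hmA
  have hlam_eq : ∀ a i, ∀ m ∈ G a i, m ∉ A → lam a i m * σ.coord i m = F a m := fun a i m hm hmA ↦
    (hu_eq a i m hm.1 hm.2 hmA).self_of_nhds
  -- Step 2: extension of `λ_{a i}` and `λ_{a i}⁻¹` across `A` (second Riemann extension theorem)
  have hΛ : ∀ a i, ∃ Λ : M → ℂ, MDifferentiableOn 𝓘(ℂ, E) 𝓘(ℂ, ℂ) Λ (G a i) ∧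
      (∀ m ∈ G a i, Λ m ≠ 0) ∧ ∀ m ∈ G a i, Λ m * σ.coord i m = F a m := by
    intro a i
    obtain ⟨Λ, hΛ, hΛeq⟩ := hAan.exists_mdifferentiableOn_eqOn_of_two_le_codim hcodim (hGo a i)
      (hlam_hol a i)
    obtain ⟨Λ', hΛ', hΛ'eq⟩ := hAan.exists_mdifferentiableOn_eqOn_of_two_le_codim hcodim (hGo a i)
      ((hlam_hol a i).inv fun m hm ↦ hlam_ne a i m hm.1 hm.2)
    have hone : EqOn (fun m ↦ Λ m * Λ' m) (fun _ ↦ (1 : ℂ)) (G a i) := by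
      refine eqOn_of_eqOn_diff_of_two_le_codim hcodim (hGo a i)
        (hΛ.continuousOn.mul hΛ'.continuousOn) continuousOn_const fun m hm ↦ ?_
      rw [hΛeq hm, hΛ'eq hm]
      exact mul_inv_cancel₀ (hlam_ne a i m hm.1 hm.2)
    have hprod : EqOn (fun m ↦ Λ m * σ.coord i m) (F a) (G a i) := by
      refine eqOn_of_eqOn_diff_of_two_le_codim hcodim (hGo a i)
        (hΛ.continuousOn.mul ((σ.mdifferentiableOn_coord i).continuousOn.mono inter_subset_left))
        ((hF_hol a).continuousOn.mono inter_subset_right) fun m hm ↦ ?_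
      rw [hΛeq hm]
      exact hlam_eq a i m hm.1 hm.2
    refine ⟨Λ, hΛ, fun m hm h0 ↦ ?_, fun m hm ↦ hprod hm⟩
    have := hone hm
    simp only [h0, zero_mul] at this
    exact zero_ne_one this
  choose Λ hΛhol hΛne hΛeq using hΛ
  -- Step 3: the holomorphic isomorphism of cocycles, `λ_{a i} = (Λ a i)`
  refine ⟨⟨fun a i x ↦ Matrix.of fun _ _ ↦ Λ a i x, fun a i x hx ↦ ?_, fun a b i j x hx ↦ ?_⟩,
    fun a i p q ↦ ?_⟩
  · rw [Matrix.isUnit_iff_isUnit_det, Matrix.det_unique]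
    exact isUnit_iff_ne_zero.2 (hΛne a i x ⟨hx.1, hx.2⟩)
  · -- condition (C): `Λ_{a i} g_{ji} = t_{ab} Λ_{b j}`, off `{σ_j = 0}` and then by density
    obtain ⟨⟨hi, hj⟩, ha, hb⟩ := hx
    set O : Set M := (L.baseSet i ∩ L.baseSet j) ∩ (Va a ∩ Va b) with hO
    have hOo : IsOpen O := ((L.isOpen_baseSet i).inter (L.isOpen_baseSet j)).inter
      ((hVao a).inter (hVao b))
    have hsc : EqOn (fun y ↦ Λ a i y * L.coordChange j i y)
        (fun y ↦ evalOrZero (D.U a ⊓ D.U b) (D.transFun a b) (φ y) * Λ b j y) O := by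
      refine eqOn_of_frequently_of_continuousOn hOo ?_ ?_ (p := fun y ↦ σ.coord j y ≠ 0)
        (fun y hy ↦ hfreq j y hy.1.2) fun y hy hσy ↦ ?_
      · exact ((hΛhol a i).continuousOn.mono fun y hy ↦ ⟨hy.1.1, hy.2.1⟩).mul
          ((L.mdifferentiableOn_coordChange j i).continuousOn.mono fun y hy ↦ ⟨hy.1.2, hy.1.1⟩)
      · exact ((IsAnalytification.mdifferentiableOn_evalOrZero_opens_holds hφ (D.U a ⊓ D.U b)
          (D.transFun a b)).continuousOn.mono fun y hy ↦ ⟨hy.2.1, hy.2.2⟩).mul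
          ((hΛhol b j).continuousOn.mono fun y hy ↦ ⟨hy.1.2, hy.2.2⟩)
      · have e1 := hΛeq a i y ⟨hy.1.1, hy.2.1⟩
        have e2 := hΛeq b j y ⟨hy.1.2, hy.2.2⟩
        have e3 := σ.coord_eq_mul j i y ⟨hy.1.2, hy.1.1⟩
        have e4 := sectionCoord_eq_mul hD.isSection_one (i := b) (j := a) hy.2.2 hy.2.1
        apply mul_right_cancel₀ hσy
        calc Λ a i y * L.coordChange j i y * σ.coord j y = Λ a i y * σ.coord i y := by rw [e3]; ring
          _ = F a y := e1
          _ = evalOrZero (D.U a ⊓ D.U b) (D.transFun a b) (φ y) * F b y := e4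
          _ = evalOrZero (D.U a ⊓ D.U b) (D.transFun a b) (φ y) * (Λ b j y * σ.coord j y) := by rw [e2]
          _ = evalOrZero (D.U a ⊓ D.U b) (D.transFun a b) (φ y) * Λ b j y * σ.coord j y := by ring
    have hx' : x ∈ O := ⟨⟨hi, hj⟩, ha, hb⟩
    have := hsc hx'
    simp only at this
    change (Matrix.of fun _ _ ↦ Λ a i x) * (Matrix.of fun _ _ ↦ L.coordChange j i x) =
      (Matrix.of fun _ _ ↦ evalOrZero (D.U a ⊓ D.U b) (D.transFun a b) (φ x)) * Matrix.of fun _ _ ↦ Λ b j x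
    rw [matrix_of_const_mul_of_const, matrix_of_const_mul_of_const, this]
  · simp only [Matrix.of_apply]
    exact hΛhol a i

/-! ### Serre's Prop. 18 for line bundles from the existence of meromorphic sections -/

/-- **`serreGAGA_lineCocycle_iso_cartierDivisorCocycle` from Kodaira–Serre sections.** If every
holomorphic line bundle `L` on a Hodge model of a smooth projective `X/ℂ` has a global holomorphic
section `σ ≢ 0` of some `L ⊗ 𝒪_X(D₂)^an` (`kodairaSerre_exists_globalSection_algebraicTwist`), then
every rank-one holomorphic cocycle `V` on `X^an` is holomorphically isomorphic to some `𝒪_X(D)^an`,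
namely `D = (σ) - D₂` (Serre: "si `D` désigne le diviseur de `s`, `D` est algébrique d'après le
théorème de Chow, et `L` est isomorphe au fibré analytique défini par `D`").
[cite: SerreGAGA1956, n° 20 Prop. 18 and Remarque 1 (pp. 31–32)] -/
theorem serreGAGA_lineCocycle_iso_cartierDivisorCocycle_of_kodairaSerre
    (hKS : kodairaSerre_exists_globalSection_algebraicTwist) :
    serreGAGA_lineCocycle_iso_cartierDivisorCocycle := by
  intro n X hX A ι V hV
  letI : AlgebraicGeometry.IsIntegral X.left := IsSmoothProjective.isIntegral_holds hX
  have h0 := SmoothComplexVectorBundle.analyticallyEquivalent_toHolomorphicLineBundle V hV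
  obtain ⟨D₂, s, hs, -, σ, hσ⟩ := hKS hX A ι (V.toHolomorphicLineBundle hV)
  obtain ⟨D₁, -, h1⟩ := analyticallyEquivalent_cartierDivisorCocycle_of_globalSection hX
    A.isAnalytification _ σ hσ
  obtain ⟨Φ, hΦ⟩ := h0.trans (analyticallyEquivalent_cartierDivisorCocycle_sub A.isAnalytification
    (V.toHolomorphicLineBundle hV) D₁ D₂ h1)
  exact ⟨D₁.sub D₂, Φ, hΦ⟩

end Literature.AlgebraicGeometry.HodgeTheory


end
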